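import Literature.AlgebraicGeometry.HodgeTheory.QuaternionicQuarticFamilyDeckBirationalOfGenericModel
import Literature.AlgebraicGeometry.HodgeTheory.QuaternionicQuarticGenericModelOfCJS
import HarnessLib

/-!
# «M1» assembly from the Cossart–Jannsen–Saito canonical resolution: `Q8FamilyDeck e` and `Q8FamilyDeckBirational e` GIVEN CJS Thm. 1.2

Layer `Literature/AlgebraicGeometry/HodgeTheory`. Two theorems (no definition, no new named fact). Route
`HodgeConjecture/Q8SymplecticPowers` (crux K1Q, stmt-HodgeConjecture-24190). The tree's `q8FamilyDeck_holds` ∕ `q8FamilyDeck_birational`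
take Kollár's all-dimension functorial-resolution fact; composing the generic-model re-keyings
(`q8FamilyDeck_of_genericModel`, `q8FamilyDeck_birational_of_genericModel`) with `exists_genericModel_of_CJS` gives the same
conclusions from the tree's named fact `Resolution.CossartJannsenSaito2020SequenceFunctorial` (CJS 2020 Thm. 1.2, canonical
functorial resolution of excellent SURFACES):

* `q8FamilyDeck_of_CJS` — `Q8FamilyDeck e` for every `e ≥ 2`, given CJS;
* `q8FamilyDeck_birational_of_CJS` — `Q8FamilyDeckBirational e` (with the fibrewise birationality clause (iii)), given CJS.

Honest scope: conditional on the CJS named fact; nothing here bears on HC.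

## References

* [CossartJannsenSaito2020] V. Cossart, U. Jannsen, S. Saito, Desingularization: invariants and strategy (LNM 2270, 2020), Thm. 1.2.
* [Kollar2007] J. Kollár, Lectures on Resolution of Singularities (2007), Thm. 3.36, §3.4.1.
* [EGAIV3] A. Grothendieck, EGA IV₃ (1966), Thm. 8.10.5.
-/

noncomputable section

open CategoryTheory AlgebraicGeometry

namespace Literature.AlgebraicGeometry.HodgeTheory.Q8Family

open Literature.AlgebraicGeometry.Resolution

/-- **`Q8FamilyDeck e` for every `e ≥ 2`, GIVEN the Cossart–Jannsen–Saito canonical resolution of surfaces.**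
[cite: CossartJannsenSaito2020, Thm. 1.2 (p. 5)] [cite: Kollar2007, Thm. 3.36 and §3.4.1] [cite: EGAIV3, Thm. 8.10.5] -/
theorem q8FamilyDeck_of_CJS (hCJS : CossartJannsenSaito2020SequenceFunctorial.{0}) (e : ℕ) (he : 2 ≤ e) :
    Q8FamilyDeck e :=
  q8FamilyDeck_of_genericModel e he (exists_genericModel_of_CJS hCJS e he)

/-- **`Q8FamilyDeckBirational e` for every `e ≥ 2`, GIVEN the Cossart–Jannsen–Saito canonical resolution of surfaces.**
[cite: CossartJannsenSaito2020, Thm. 1.2 (p. 5)] [cite: Kollar2007, Thm. 3.36 and §3.4.1] [cite: Hartshorne1977, I Example 1.1.3] -/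
theorem q8FamilyDeck_birational_of_CJS (hCJS : CossartJannsenSaito2020SequenceFunctorial.{0}) (e : ℕ) (he : 2 ≤ e) :
    Q8FamilyDeckBirational e :=
  q8FamilyDeck_birational_of_genericModel e he (exists_genericModel_of_CJS hCJS e he)

end Literature.AlgebraicGeometry.HodgeTheory.Q8Family

end
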